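import Literature.NumberTheory.DiophantineGeometry.AbcShapeEndgame13
import HarnessLib

/-!
# Discharge of Theorem 1.3 of Bernert–Browning–Lichtman–Teräväinen (`N_λ(X) ≪ X^{0.6+ε}`, `λ < 1`)

This file DISCHARGES the named fact
`Literature.NumberTheory.DiophantineGeometry.bernertEtAl2024_thm_1_3` of
`Literature.NumberTheory.DiophantineGeometry.AbcExceptionalSetBounds`:

> **Theorem 1.3** (arXiv:2410.12234v2, 9 May 2026). Let `λ ∈ (0, 1)`. Then
> `N_λ(X) ≪_{ε,λ} X^{0.6+ε}`, for any `ε > 0`.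

The proof follows v2 of the source (§§2–4, §6): the reduction of `N_λ(X)` to the shape counts
`B_M(c; X, Y, Z)` (`AbcShapeFactorisation` = Lemma 2.2, `AbcShapeReduction`,
`AbcShapeReductionCount` = Prop. 2.1), the trivial bound (`AbcShapeTrivialBound` = Prop. 2.3), the
geometry-of-numbers bound for index sets (`CongruenceLatticeBoxCount`, `AbcShapeSubBox`,
`AbcShapeGeometrySets` = Prop. 4.1), the Fourier bound with saved sets (`FourierPositivityCount` —
the only analytic input, proved with finite Fourier analysis — `AbcShapeMoments`,
`AbcShapeFourthMoment`, `AbcShapeFourthMomentSets`, `AbcShapeFourierBoundSets` = Prop. 3.1), the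
exponent dictionary (`AbcShapeExponents`, `AbcShapeLPInstance`), the linear programme Prop. 6.1
PROVED in `AbcLinearProgram` (a 46-leaf branch-and-bound certificate closed by `linarith`), and
the endgame `AbcShapeEndgame13.shapeCount_le_of_admissible_lt_one`. What remains here is the
choice of the small parameter `ε' = min((1-λ)/3, ε/3, 1/4)` (so that `λ + 3ε' ≤ 1`, which is
where `λ < 1` enters). Theorem 1.2 of the source (`bernertEtAl2024_thm_1_2`) is discharged in
`AbcExceptionalSetBoundsThm12Proofs` (an independent formalisation of Bernert's argument at
`d = 4`); `AbcShapeEndgame` gives a second route to it through the present machinery.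

## References

* [BernertEtAl2024] C. Bernert, T. Browning, J. D. Lichtman, J. Teräväinen, *Bounds on the
  exceptional set in the abc conjecture*, arXiv:2410.12234: v2 (9 May 2026) Theorem 1.3,
  §§2–4, §6 (Proposition 6.1), Appendix A.
-/

noncomputable section

open Finset

namespace Literature.NumberTheory.DiophantineGeometry

/-! ### Discharge of Theorem 1.3 -/

/-- `⌊10/ε²⌋ ≥ 6` for `0 < ε ≤ 1/4`. [folklore] -/
theorem six_le_numShapes {ε : ℝ} (hε : 0 < ε) (hε4 : ε ≤ 1 / 4) : 6 ≤ AbcShapes.numShapes ε := by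
  show 6 ≤ ⌊10 / ε ^ 2⌋₊
  refine Nat.le_floor ?_
  rw [Nat.cast_ofNat, le_div_iff₀ (by positivity)]
  have h1 : ε ^ 2 ≤ 1 := pow_le_one₀ hε.le (by linarith)
  linarith

open AbcShapes in
/-- **Bernert–Browning–Lichtman–Teräväinen, Theorem 1.3 — discharge of the named fact
`bernertEtAl2024_thm_1_3`.** For `λ ∈ (0, 1)` and `ε > 0` there is `C` with
`N_λ(X) ≤ C · X^{0.6 + ε}` for all `X ≥ 2`. Proof (arXiv:2410.12234v2, §6): with
`ε' = min((1-λ)/3, ε/3, 1/4)` (so `λ + 3ε' ≤ 1`), `M = ⌊10/ε'²⌋ = 6 + e`, the reduction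
`abcExponentCount_le_of_shapeCount_le` bounds `N_λ(X)` by `K · #classRange ε' X · X^θ` as soon as
`B_M ≤ K C₀^θ` on admissible data, which `shapeCount_le_of_admissible_lt_one` provides with
`θ = 3/5 + ε/4` (via the linear programme `linear_program`, Prop. 6.1 of the source); and
`#classRange ε' X ≤ C' X^{3ε'/2 + ε/4}`. The exponents add up to at most `3/5 + ε`.
[cite: BernertEtAl2024, Thm. 1.3 (arXiv v2)] -/
theorem bernertEtAl2024_thm_1_3_holds : bernertEtAl2024_thm_1_3 := by
  intro l hl hl1 ε hε
  -- the small parameter `ε'`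
  obtain ⟨ε', hε'⟩ : ∃ t : ℝ, t = min (min ((1 - l) / 3) (ε / 3)) (1 / 4) := ⟨_, rfl⟩
  have hε'0 : 0 < ε' := by
    rw [hε']; exact lt_min (lt_min (by linarith) (by positivity)) (by norm_num)
  have hε'l : l + 3 * ε' ≤ 1 := by
    have : ε' ≤ (1 - l) / 3 := by rw [hε']; exact (min_le_left _ _).trans (min_le_left _ _)
    linarith
  have hε'ε : ε' ≤ ε / 3 := by rw [hε']; exact (min_le_left _ _).trans (min_le_right _ _)
  have hε'4 : ε' ≤ 1 / 4 := by rw [hε']; exact min_le_right _ _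
  have hε'2 : ε' < 1 / 2 := by linarith
  have hη : 0 < ε / 4 := by positivity
  -- the dimension `M = 6 + e`
  obtain ⟨e, he⟩ : ∃ e : ℕ, numShapes ε' = 6 + e :=
    ⟨numShapes ε' - 6, by have := six_le_numShapes hε'0 hε'4; omega⟩
  -- the bound for `B_M` on admissible data (`λ + 3ε' ≤ 1`)
  obtain ⟨K, hK0, hK⟩ := shapeCount_le_of_admissible_lt_one e hε'l hη
  have hθ0 : (0 : ℝ) ≤ 3 / 5 + ε / 4 := by positivity
  have hB : ∀ (C₀ c₁ c₂ c₃ : ℕ) (X Y Z : Fin (numShapes ε') → ℕ),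
      Admissible l ε' C₀ c₁ c₂ c₃ X Y Z →
        (shapeCount c₁ c₂ c₃ X Y Z : ℝ) ≤ K * (C₀ : ℝ) ^ (3 / 5 + ε / 4) := by
    rw [he]; exact hK
  -- the reduction and the number of classes
  have hred := abcExponentCount_le_of_shapeCount_le hε'0 hε'2 hl.le hθ0 hK0 hB
  obtain ⟨C, hC0, hC⟩ := card_classRange_le ε' hη
  refine ⟨K * C, fun X hX => ?_⟩
  have hX1 : (1 : ℝ) ≤ X := by exact_mod_cast (by omega : 1 ≤ X)
  have hX0 : (0 : ℝ) < X := by positivity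
  have hexp : (X : ℝ) ^ (3 * ε' / 2 + ε / 4) * (X : ℝ) ^ (3 / 5 + ε / 4) ≤ (X : ℝ) ^ (3 / 5 + ε : ℝ) := by
    rw [← Real.rpow_add hX0]
    exact Real.rpow_le_rpow_of_exponent_le hX1 (by linarith)
  calc (abcExponentCount l X : ℝ) ≤ K * (classRange ε' X).card * (X : ℝ) ^ (3 / 5 + ε / 4) := hred X
    _ ≤ K * (C * (X : ℝ) ^ (3 * ε' / 2 + ε / 4)) * (X : ℝ) ^ (3 / 5 + ε / 4) :=
        mul_le_mul_of_nonneg_right (mul_le_mul_of_nonneg_left (hC X hX) hK0) (by positivity)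
    _ = K * C * ((X : ℝ) ^ (3 * ε' / 2 + ε / 4) * (X : ℝ) ^ (3 / 5 + ε / 4)) := by ring
    _ ≤ K * C * (X : ℝ) ^ (3 / 5 + ε : ℝ) :=
        mul_le_mul_of_nonneg_left hexp (mul_nonneg hK0 hC0.le)

end Literature.NumberTheory.DiophantineGeometry
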